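import Summits.Ventures.Crystal3D.Bulk.CapBoxRect
import HarnessLib

/-!
# Tensor-Bernstein branch and bound on rectangular tensors: the search and the end-to-end check

Venture `Crystal3D` (cell `pub-crystal3d`, phase 2; seat typer-bulk). On top of `CapBoxRect.lean`:

* `bnbR n₀ n₁ n₂` — the search of `CapBoxSprocZ.bnbZ` (sign tests, integer S-procedure rule, de Casteljau
  halving cycling through the axes) with the threshold scaled by `2^{nᵢ}` after a split along axis `i`;
  `bnbR_sound`;
* `pad3R n₀ n₁ n₂` (zero padding to shape `(n₀+1) × (n₁+1) × (n₂+1)`), `eval3_pad3R`; the root lemmas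
  `shape3R_toBern3`, `shape3R_map3`, `val3QR_toBern3`, `val3NR_toNat3_le`, `le_val3NR_toNat3Up`;
* `checkPos3R P n₀ n₁ n₂ lo₀ hi₀ lo₁ hi₁ lo₂ hi₂ NB NGB fuel` and **`nonneg_of_checkPos3R`** — the same conclusion
  as `nonneg_of_checkPos3` / `…3S` / `…3Z`: a `true` run proves `eval3 P u v t ≥ 0` at every point of the box with
  `1 + 2uvt - u² - v² - t² ≥ 0`.
Everything is structurally recursive. HONEST FRAMING: bookkeeping [folklore]; nothing geometric is proved here.
-/

open Finset

namespace Summit.Ventures.Crystal3D.CapCut.Bern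

/-! ### The search -/

/-- Degree of axis `ax` (`0 = u`, `1 = v`, otherwise `t`). [folklore] -/
def degAx (n0 n1 n2 : ℕ) : ℕ → ℕ
  | 0 => n0
  | 1 => n1
  | _ => n2

/-- The branch and bound on rectangular tensors (integer S-procedure rule; a split along axis `i` scales the
thresholds by `2^{nᵢ}`). [folklore] -/
def bnbR (n0 n1 n2 : ℕ) : ℕ → ℕ → T3 → ℕ → T3 → ℕ → Bool
  | 0, _, _, _, _, _ => false
  | fuel + 1, ax, Y, θ, H, η =>
    allGe3 θ Y ||
      (allLt3 η H ||
        (accZ (sigmaZ θ η Y H) θ η Y H ||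
          (bnbR n0 n1 n2 fuel (nextAx ax) (splitL ax Y) (sc0 (degAx n0 n1 n2 ax) θ) (splitL ax H)
              (sc0 (degAx n0 n1 n2 ax) η) &&
            bnbR n0 n1 n2 fuel (nextAx ax) (splitR ax Y) (sc0 (degAx n0 n1 n2 ax) θ) (splitR ax H)
              (sc0 (degAx n0 n1 n2 ax) η))))

set_option maxHeartbeats 800000 in
/-- **Soundness of the rectangular search.** [folklore] -/
theorem bnbR_sound (n0 n1 n2 : ℕ) : ∀ (fuel ax : ℕ) (Y : T3) (θ : ℕ) (H : T3) (η : ℕ),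
    bnbR n0 n1 n2 fuel ax Y θ H η = true → Shape3R n0 n1 n2 Y → Shape3R n0 n1 n2 H →
    ∀ s1 s2 s3 : ℝ, 0 ≤ s1 → s1 ≤ 1 → 0 ≤ s2 → s2 ≤ 1 → 0 ≤ s3 → s3 ≤ 1 →
      (η : ℝ) ≤ val3NR n0 n1 n2 H s1 s2 s3 → (θ : ℝ) ≤ val3NR n0 n1 n2 Y s1 s2 s3 := by
  intro fuel
  induction fuel with
  | zero => intro ax Y θ H η h; simp [bnbR] at h
  | succ fuel ih =>
    intro ax Y θ H η h hY hH s1 s2 s3 h10 h11 h20 h21 h30 h31 hval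
    simp only [bnbR, Bool.or_eq_true, Bool.and_eq_true] at h
    rcases h with hge | hlt | hsp | ⟨hl, hr⟩
    · exact le_val3NR_of_allGe3 n0 n1 n2 Y hY θ hge h10 h11 h20 h21 h30 h31
    · exact absurd hval (not_le.2 (val3NR_lt_of_allLt3 n0 n1 n2 H hH η hlt h10 h11 h20 h21 h30 h31))
    · exact le_val3NR_of_accZ n0 n1 n2 θ η _ Y H hY hH hsp h10 h11 h20 h21 h30 h31 hval
    · have ihL := ih _ _ _ _ _ hl (shape3R_splitL n0 n1 n2 ax Y hY) (shape3R_splitL n0 n1 n2 ax H hH)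
      have ihR := ih _ _ _ _ _ hr (shape3R_splitR n0 n1 n2 ax Y hY) (shape3R_splitR n0 n1 n2 ax H hH)
      match ax with
      | 0 =>
        exact split_step n0 n0 θ η (fun x => val3NR n0 n1 n2 Y x s2 s3) (fun x => val3NR n0 n1 n2 H x s2 s3)
          (fun x => val3NR n0 n1 n2 (splitL 0 Y) x s2 s3) (fun x => val3NR n0 n1 n2 (splitL 0 H) x s2 s3)
          (fun x => val3NR n0 n1 n2 (splitR 0 Y) x s2 s3) (fun x => val3NR n0 n1 n2 (splitR 0 H) x s2 s3)
          (fun x => val3NR_splitL0 n0 n1 n2 Y hY x s2 s3) (fun x => val3NR_splitL0 n0 n1 n2 H hH x s2 s3)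
          (fun x => val3NR_splitR0 n0 n1 n2 Y hY x s2 s3) (fun x => val3NR_splitR0 n0 n1 n2 H hH x s2 s3)
          (fun s' h0' h1' hv => ihL s' s2 s3 h0' h1' h20 h21 h30 h31 hv)
          (fun s' h0' h1' hv => ihR s' s2 s3 h0' h1' h20 h21 h30 h31 hv) s1 h10 h11 hval
      | 1 =>
        exact split_step n1 n1 θ η (fun x => val3NR n0 n1 n2 Y s1 x s3) (fun x => val3NR n0 n1 n2 H s1 x s3)
          (fun x => val3NR n0 n1 n2 (splitL 1 Y) s1 x s3) (fun x => val3NR n0 n1 n2 (splitL 1 H) s1 x s3)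
          (fun x => val3NR n0 n1 n2 (splitR 1 Y) s1 x s3) (fun x => val3NR n0 n1 n2 (splitR 1 H) s1 x s3)
          (fun x => val3NR_splitL1 n0 n1 n2 Y hY s1 x s3) (fun x => val3NR_splitL1 n0 n1 n2 H hH s1 x s3)
          (fun x => val3NR_splitR1 n0 n1 n2 Y hY s1 x s3) (fun x => val3NR_splitR1 n0 n1 n2 H hH s1 x s3)
          (fun s' h0' h1' hv => ihL s1 s' s3 h10 h11 h0' h1' h30 h31 hv)
          (fun s' h0' h1' hv => ihR s1 s' s3 h10 h11 h0' h1' h30 h31 hv) s2 h20 h21 hval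
      | k + 2 =>
        exact split_step n2 n2 θ η (fun x => val3NR n0 n1 n2 Y s1 s2 x) (fun x => val3NR n0 n1 n2 H s1 s2 x)
          (fun x => val3NR n0 n1 n2 (splitL (k + 2) Y) s1 s2 x) (fun x => val3NR n0 n1 n2 (splitL (k + 2) H) s1 s2 x)
          (fun x => val3NR n0 n1 n2 (splitR (k + 2) Y) s1 s2 x) (fun x => val3NR n0 n1 n2 (splitR (k + 2) H) s1 s2 x)
          (fun x => val3NR_splitL2 n0 n1 n2 k Y hY s1 s2 x) (fun x => val3NR_splitL2 n0 n1 n2 k H hH s1 s2 x)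
          (fun x => val3NR_splitR2 n0 n1 n2 k Y hY s1 s2 x) (fun x => val3NR_splitR2 n0 n1 n2 k H hH s1 s2 x)
          (fun s' h0' h1' hv => ihL s1 s2 s' h10 h11 h20 h21 h0' h1' hv)
          (fun s' h0' h1' hv => ihR s1 s2 s' h10 h11 h20 h21 h0' h1' hv) s3 h30 h31 hval

/-! ### Padding to a rectangular shape -/

/-- Zero padding of a slice to `(n₁+1)` lines of `(n₂+1)` entries (when no list is longer). [folklore] -/
def pad2R (n1 n2 : ℕ) (l : QT2) : QT2 := (l ++ List.replicate (n1 + 1 - l.length) []).map (pad1 n2)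

/-- Zero padding of a tensor to shape `(n₀+1) × (n₁+1) × (n₂+1)` (when no list is longer). [folklore] -/
def pad3R (n0 n1 n2 : ℕ) (l : QT3) : QT3 := (l ++ List.replicate (n0 + 1 - l.length) []).map (pad2R n1 n2)

/-- Padding does not change the value. [folklore] -/
theorem eval3_pad3R (n0 n1 n2 : ℕ) (P : QT3) (u v t : ℝ) : eval3 (pad3R n0 n1 n2 P) u v t = eval3 P u v t := by
  have h1 : ∀ ln : QT1, ev1 (pad1 n2 ln) t = ev1 ln t := fun ln =>
    pvF_append_replicate (F := fun q : ℚ => (q : ℝ)) (by simp) ln _ t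
  have h2 : ∀ sl : QT2, ev2 (pad2R n1 n2 sl) v t = ev2 sl v t := by
    intro sl
    unfold ev2 pad2R
    rw [pvF_map, pvF_append_replicate (F := (fun ln => ev1 ln t) ∘ pad1 n2) (by show ev1 (pad1 n2 []) t = 0; rw [h1]; rfl)]
    exact pvF_congr_mem sl v fun ln _ => by simp [Function.comp, h1]
  rw [eval3_eq, eval3_eq, pad3R, pvF_map,
    pvF_append_replicate (F := (fun sl => ev2 sl v t) ∘ pad2R n1 n2) (by show ev2 (pad2R n1 n2 []) v t = 0; rw [h2]; rfl)]
  exact pvF_congr_mem P u fun sl _ => by simp [Function.comp, h2]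

/-! ### Shapes and values at the root -/

/-- Rational slice shape predicate with two degrees. [folklore] -/
def PQ2R (n1 n2 : ℕ) (sl : QT2) : Prop := sl.length = n1 + 1 ∧ ∀ ln ∈ sl, PQ1 n2 ln

/-- `qadd2` preserves the slice shape. [folklore] -/
theorem qadd2_PQ2R (n1 n2 : ℕ) (a b : QT2) (ha : PQ2R n1 n2 a) (hb : PQ2R n1 n2 b) : PQ2R n1 n2 (qadd2 a b) :=
  ⟨lzip_length _ a b _ ha.1 hb.1, lzip_forall qadd1 (PQ1 n2) (qadd1_PQ1 n2) a b ha.2 hb.2⟩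

/-- `qsmul2` preserves the slice shape. [folklore] -/
theorem qsmul2_PQ2R (n1 n2 : ℕ) (c : ℚ) (a : QT2) (ha : PQ2R n1 n2 a) : PQ2R n1 n2 (qsmul2 c a) := by
  refine ⟨by unfold qsmul2; rw [List.length_map, ha.1], fun ln hln => ?_⟩
  unfold qsmul2 at hln; rw [List.mem_map] at hln
  obtain ⟨ln', h', rfl⟩ := hln
  exact qsmul1_PQ1 n2 c ln' (ha.2 ln' h')

/-- The conversion preserves the rectangular shape. [folklore] -/
theorem shape3R_toBern3 (n0 n1 n2 : ℕ) (lo0 hi0 lo1 hi1 lo2 hi2 : ℚ) (P : QT3) (hP : Shape3R n0 n1 n2 P) :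
    Shape3R n0 n1 n2 (toBern3 lo0 hi0 lo1 hi1 lo2 hi2 P) := by
  unfold toBern3
  have hX : ∀ sl ∈ P.map (fun sl => toBern qadd1 qsmul1 lo1 hi1 (sl.map fun ln => toBern (· + ·) (· * ·) lo2 hi2 ln)),
      PQ2R n1 n2 sl := by
    intro sl hsl
    rw [List.mem_map] at hsl
    obtain ⟨sl', hsl', rfl⟩ := hsl
    refine ⟨by rw [toBern_length, List.length_map]; exact (hP.2 sl' hsl').1, ?_⟩
    refine toBern_forall qadd1 qsmul1 (PQ1 n2) (qadd1_PQ1 n2) (qsmul1_PQ1 n2) lo1 hi1 _ ?_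
    intro ln hln
    rw [List.mem_map] at hln
    obtain ⟨ln', hln', rfl⟩ := hln
    unfold PQ1; rw [toBern_length]; exact (hP.2 sl' hsl').2 ln' hln'
  refine ⟨by rw [toBern_length, List.length_map, hP.1], ?_⟩
  exact toBern_forall qadd2 qsmul2 (PQ2R n1 n2) (qadd2_PQ2R n1 n2) (qsmul2_PQ2R n1 n2) lo0 hi0 _ hX

/-- Triple maps preserve the rectangular shape. [folklore] -/
theorem shape3R_map3 {β γ : Type} (n0 n1 n2 : ℕ) (f : β → γ) (B : List (List (List β))) (hB : Shape3R n0 n1 n2 B) :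
    Shape3R n0 n1 n2 (B.map fun sl => sl.map fun ln => ln.map f) := by
  refine ⟨by rw [List.length_map, hB.1], fun sl hsl => ?_⟩
  rw [List.mem_map] at hsl
  obtain ⟨sl', hsl', rfl⟩ := hsl
  refine ⟨by rw [List.length_map]; exact (hB.2 sl' hsl').1, fun ln hln => ?_⟩
  rw [List.mem_map] at hln
  obtain ⟨ln', hln', rfl⟩ := hln
  rw [List.length_map]; exact (hB.2 sl' hsl').2 ln' hln'

/-- **The conversion is sound on rectangular tensors.** [folklore] -/
theorem val3QR_toBern3 (n0 n1 n2 : ℕ) (P : QT3) (hP : Shape3R n0 n1 n2 P) (lo0 hi0 lo1 hi1 lo2 hi2 : ℚ)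
    (s1 s2 s3 : ℝ) :
    val3QR n0 n1 n2 (toBern3 lo0 hi0 lo1 hi1 lo2 hi2 P) s1 s2 s3 =
      eval3 P ((lo0 : ℝ) * (1 - s1) + hi0 * s1) ((lo1 : ℝ) * (1 - s2) + hi1 * s2) ((lo2 : ℝ) * (1 - s3) + hi2 * s3) := by
  unfold val3QR toBern3 eval3
  set X := P.map (fun sl => toBern qadd1 qsmul1 lo1 hi1 (sl.map fun ln => toBern (· + ·) (· * ·) lo2 hi2 ln)) with hX
  have hlen : X.length - 1 = n0 := by rw [hX, List.length_map, hP.1]; rfl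
  have h1 := bvF_toBern (linQ2R n1 n2 s2 s3) lo0 hi0 s1 X
  rw [hlen] at h1
  rw [h1, hX, pvF_map]
  refine pvF_congr_mem P _ fun sl hsl => ?_
  simp only [Function.comp]
  have hlen2 : (sl.map fun ln => toBern (· + ·) (· * ·) lo2 hi2 ln).length - 1 = n1 := by
    rw [List.length_map, (hP.2 sl hsl).1]; rfl
  have h2 := bvF_toBern (linQ1 n2 s3) lo1 hi1 s2 (sl.map fun ln => toBern (· + ·) (· * ·) lo2 hi2 ln)
  rw [hlen2] at h2
  rw [h2, pvF_map]
  refine pvF_congr_mem sl _ fun ln hln => ?_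
  simp only [Function.comp]
  have hlen3 : ln.length - 1 = n2 := by rw [(hP.2 sl hsl).2 ln hln]; rfl
  have h3 := bvF_toBern linQ0 lo2 hi2 s3 ln
  rw [hlen3] at h3
  exact h3

/-- Lower integerisation is an outward rounding (rectangular). [folklore] -/
theorem val3NR_toNat3_le (n0 n1 n2 : ℕ) (B : QT3) (hB : Shape3R n0 n1 n2 B) (N M : ℕ) (hoff : offsetOK N M B = true)
    {s1 s2 s3 : ℝ} (h10 : 0 ≤ s1) (h11 : s1 ≤ 1) (h20 : 0 ≤ s2) (h21 : s2 ≤ 1) (h30 : 0 ≤ s3) (h31 : s3 ≤ 1) :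
    val3NR n0 n1 n2 (toNat3 N M B) s1 s2 s3 ≤ (N : ℝ) * val3QR n0 n1 n2 B s1 s2 s3 + M := by
  simp only [offsetOK, List.all_eq_true, decide_eq_true_eq] at hoff
  unfold val3NR val3QR toNat3
  refine bvF_map_le_affine _ (N : ℝ) (M : ℝ) n0 h10 h11 B hB.1 fun sl hsl => ?_
  refine bvF_map_le_affine _ (N : ℝ) (M : ℝ) n1 h20 h21 sl (hB.2 sl hsl).1 fun ln hln => ?_
  refine bvF_map_le_affine _ (N : ℝ) (M : ℝ) n2 h30 h31 ln ((hB.2 sl hsl).2 ln hln) fun q hq => ?_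
  have h0 := hoff sl hsl ln hln q hq
  have hc : (((⌊(N : ℚ) * q⌋ + M).toNat : ℕ) : ℝ) = ((⌊(N : ℚ) * q⌋ + M : ℤ) : ℝ) := by
    exact_mod_cast Int.toNat_of_nonneg h0
  rw [hc]; push_cast
  have hf : ((⌊(N : ℚ) * q⌋ : ℤ) : ℝ) ≤ (N : ℝ) * (q : ℝ) := by
    have := Int.floor_le ((N : ℚ) * q)
    exact_mod_cast this
  linarith

/-- Upper integerisation is an outward rounding (rectangular). [folklore] -/
theorem le_val3NR_toNat3Up (n0 n1 n2 : ℕ) (B : QT3) (hB : Shape3R n0 n1 n2 B) (N M : ℕ)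
    (hoff : offsetOKUp N M B = true) {s1 s2 s3 : ℝ} (h10 : 0 ≤ s1) (h11 : s1 ≤ 1) (h20 : 0 ≤ s2) (h21 : s2 ≤ 1)
    (h30 : 0 ≤ s3) (h31 : s3 ≤ 1) :
    (N : ℝ) * val3QR n0 n1 n2 B s1 s2 s3 + M ≤ val3NR n0 n1 n2 (toNat3Up N M B) s1 s2 s3 := by
  simp only [offsetOKUp, List.all_eq_true, decide_eq_true_eq] at hoff
  unfold val3NR val3QR toNat3Up
  refine le_bvF_map_affine _ (N : ℝ) (M : ℝ) n0 h10 h11 B hB.1 fun sl hsl => ?_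
  refine le_bvF_map_affine _ (N : ℝ) (M : ℝ) n1 h20 h21 sl (hB.2 sl hsl).1 fun ln hln => ?_
  refine le_bvF_map_affine _ (N : ℝ) (M : ℝ) n2 h30 h31 ln ((hB.2 sl hsl).2 ln hln) fun q hq => ?_
  have h0 := hoff sl hsl ln hln q hq
  have hc : (((⌈(N : ℚ) * q⌉ + M).toNat : ℕ) : ℝ) = ((⌈(N : ℚ) * q⌉ + M : ℤ) : ℝ) := by
    exact_mod_cast Int.toNat_of_nonneg h0
  rw [hc]; push_cast
  have hf : (N : ℝ) * (q : ℝ) ≤ ((⌈(N : ℚ) * q⌉ : ℤ) : ℝ) := by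
    have := Int.le_ceil ((N : ℚ) * q)
    exact_mod_cast this
  linarith

/-! ### End to end -/

/-- **The rectangular check** for «`P ≥ 0` on `[lo₀,hi₀]×[lo₁,hi₁]×[lo₂,hi₂] ∩ {Gram ≥ 0}`»: `P` must have shape
exactly `(n₀+1) × (n₁+1) × (n₂+1)` (pad with `pad3R`); conversion, integerisation at scales `2^NB` / `2^NGB`, the
Gram polynomial padded to the same shape, and the search `bnbR` with depth `≤ fuel`. [folklore] -/
def checkPos3R (P : QT3) (n0 n1 n2 : ℕ) (lo0 hi0 lo1 hi1 lo2 hi2 : ℚ) (NB NGB fuel : ℕ) : Bool :=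
  let B := toBern3 lo0 hi0 lo1 hi1 lo2 hi2 P
  let N : ℕ := 2 ^ NB
  let M : ℕ := (-(⌊(N : ℚ) * minEntry3 B⌋)).toNat
  let G := toBern3 lo0 hi0 lo1 hi1 lo2 hi2 (pad3R n0 n1 n2 gramQ3)
  let NG : ℕ := 2 ^ NGB
  let MG : ℕ := (-(⌊(NG : ℚ) * minEntry3 G⌋)).toNat + 1
  shapeOK3R n0 n1 n2 P && shapeOK3R n0 n1 n2 (pad3R n0 n1 n2 gramQ3) && decide (lo0 < hi0) && decide (lo1 < hi1) &&
    decide (lo2 < hi2) && offsetOK N M B && offsetOKUp NG MG G &&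
      bnbR n0 n1 n2 fuel 0 (toNat3 N M B) M (toNat3Up NG MG G) MG

/-- **Soundness of the rectangular check** (same conclusion as `nonneg_of_checkPos3`). [folklore] -/
theorem nonneg_of_checkPos3R (P : QT3) (n0 n1 n2 : ℕ) (lo0 hi0 lo1 hi1 lo2 hi2 : ℚ) (NB NGB fuel : ℕ)
    (h : checkPos3R P n0 n1 n2 lo0 hi0 lo1 hi1 lo2 hi2 NB NGB fuel = true) :
    ∀ u v t : ℝ, (lo0 : ℝ) ≤ u → u ≤ hi0 → (lo1 : ℝ) ≤ v → v ≤ hi1 → (lo2 : ℝ) ≤ t → t ≤ hi2 →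
      0 ≤ 1 + 2 * u * v * t - u ^ 2 - v ^ 2 - t ^ 2 → 0 ≤ eval3 P u v t := by
  intro u v t hu0 hu1 hv0 hv1 ht0 ht1 hgram
  simp only [checkPos3R, Bool.and_eq_true, decide_eq_true_eq] at h
  obtain ⟨⟨⟨⟨⟨⟨⟨hshape, hshapeG⟩, hl0⟩, hl1⟩, hl2⟩, hoff⟩, hoffG⟩, hbnb⟩ := h
  set B := toBern3 lo0 hi0 lo1 hi1 lo2 hi2 P with hB
  set G := toBern3 lo0 hi0 lo1 hi1 lo2 hi2 (pad3R n0 n1 n2 gramQ3) with hG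
  set N : ℕ := 2 ^ NB with hN
  set NG : ℕ := 2 ^ NGB with hNG
  set M : ℕ := (-(⌊(N : ℚ) * minEntry3 B⌋)).toNat with hM
  set MG : ℕ := (-(⌊(NG : ℚ) * minEntry3 G⌋)).toNat + 1 with hMG
  have hP : Shape3R n0 n1 n2 P := shape3R_of_shapeOK3R n0 n1 n2 P hshape
  have hPG : Shape3R n0 n1 n2 (pad3R n0 n1 n2 gramQ3) := shape3R_of_shapeOK3R n0 n1 n2 _ hshapeG
  have hBs : Shape3R n0 n1 n2 B := shape3R_toBern3 n0 n1 n2 _ _ _ _ _ _ P hP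
  have hGs : Shape3R n0 n1 n2 G := shape3R_toBern3 n0 n1 n2 _ _ _ _ _ _ _ hPG
  have hYs : Shape3R n0 n1 n2 (toNat3 N M B) := shape3R_map3 n0 n1 n2 _ B hBs
  have hHs : Shape3R n0 n1 n2 (toNat3Up NG MG G) := shape3R_map3 n0 n1 n2 _ G hGs
  have d0 : (0 : ℝ) < hi0 - lo0 := by
    have h' : ((lo0 : ℚ) : ℝ) < hi0 := by exact_mod_cast hl0
    linarith
  have d1 : (0 : ℝ) < hi1 - lo1 := by
    have h' : ((lo1 : ℚ) : ℝ) < hi1 := by exact_mod_cast hl1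
    linarith
  have d2 : (0 : ℝ) < hi2 - lo2 := by
    have h' : ((lo2 : ℚ) : ℝ) < hi2 := by exact_mod_cast hl2
    linarith
  set s1 := (u - lo0) / (hi0 - lo0) with hs1
  set s2 := (v - lo1) / (hi1 - lo1) with hs2
  set s3 := (t - lo2) / (hi2 - lo2) with hs3
  have h10 : 0 ≤ s1 := div_nonneg (by linarith) d0.le
  have h11 : s1 ≤ 1 := (div_le_one d0).2 (by linarith)
  have h20 : 0 ≤ s2 := div_nonneg (by linarith) d1.le
  have h21 : s2 ≤ 1 := (div_le_one d1).2 (by linarith)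
  have h30 : 0 ≤ s3 := div_nonneg (by linarith) d2.le
  have h31 : s3 ≤ 1 := (div_le_one d2).2 (by linarith)
  have e0 : (lo0 : ℝ) * (1 - s1) + hi0 * s1 = u := by rw [hs1]; field_simp; ring
  have e1 : (lo1 : ℝ) * (1 - s2) + hi1 * s2 = v := by rw [hs2]; field_simp; ring
  have e2 : (lo2 : ℝ) * (1 - s3) + hi2 * s3 = t := by rw [hs3]; field_simp; ring
  have hHval : (MG : ℝ) ≤ val3NR n0 n1 n2 (toNat3Up NG MG G) s1 s2 s3 := by
    have hup := le_val3NR_toNat3Up n0 n1 n2 G hGs NG MG hoffG h10 h11 h20 h21 h30 h31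
    rw [hG, val3QR_toBern3 n0 n1 n2 _ hPG, e0, e1, e2, eval3_pad3R, eval3_gramQ3] at hup
    have : (0 : ℝ) ≤ (NG : ℝ) * (1 + 2 * u * v * t - u ^ 2 - v ^ 2 - t ^ 2) := by positivity
    linarith
  have hY := bnbR_sound n0 n1 n2 fuel 0 _ M _ MG hbnb hYs hHs s1 s2 s3 h10 h11 h20 h21 h30 h31 hHval
  have hle := val3NR_toNat3_le n0 n1 n2 B hBs N M hoff h10 h11 h20 h21 h30 h31
  rw [hB, val3QR_toBern3 n0 n1 n2 P hP, e0, e1, e2] at hle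
  have hNpos : (0 : ℝ) < N := by rw [hN]; positivity
  have hNe : (0 : ℝ) ≤ (N : ℝ) * eval3 P u v t := by linarith
  by_contra hneg
  push Not at hneg
  have : (N : ℝ) * eval3 P u v t < 0 := mul_neg_of_pos_of_neg hNpos hneg
  linarith

end Summit.Ventures.Crystal3D.CapCut.Bern
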